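import Summits.MatrixMultiplication.MatrixMultiplication.Theorems.LevelGradedCohnUmansGradedDesignFamilyStubSubfieldCellTwentyfivePackLines

/-!
# Existential (per-target) form of the line-form packaging lemma, `|K| = 25`

Route `LevelGradedCohnUmans`, crux `GradedDesignFamily` (stmt-MatrixMultiplication-7610), line
`quadratic_extension_level_one_cell`, stub S3 `stub_subfieldCell`.  HONEST FRAMING: bookkeeping for the
compiler-checked TRUE finite instances of the stub's inner clause at `q = 5`; NOT summit progress.

`subfieldCell_twentyfive_pack_lines` takes the per-target integer line tables `R j` and denominators `N j` as
functions of the target index.  This variant takes, for each target `j`, the EXISTENCE of a table and a positive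
denominator satisfying the line-form separation identities — so that the identities of different targets can be
proved in different files (one `native_decide` each) and assembled, when a single file would exceed the size cap.
-/

namespace Summit.MatrixMultiplication.MatrixMultiplication.Theorems.GradedDesignFamily

open Matrix

/-- Per-target existential form of `subfieldCell_twentyfive_pack_lines`: if every target `z_j` admits SOME
integer line table `R` on the representatives `urep` and SOME denominator `N > 0` with
`∑_t R t (X · urep t) = N · [g = 1 ∧ y_i = y_i' ∧ z_l = z_j]` for all `g, i, i', l`, the clause of
`stub_subfieldCell` holds for `Y = range yOf`, `Z = range zOf` at `|K| = 25`.  (`choose` + the line-form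
lemma; certificate bookkeeping, not summit progress.) -/
theorem subfieldCell_twentyfive_pack_lines_exists [hp : Fact (Nat.Prime 5)] [hF : Fact (∀ r : ZMod 5, r ^ 2 ≠ 2 + 0 * r)]
    [hK : Fintype (QuadraticAlgebra (ZMod 5) 2 0)] (h9 : Fintype.card (QuadraticAlgebra (ZMod 5) 2 0) = 25) {ny nz nt : ℕ}
    (yOf : Fin ny → GL (Fin 2) (QuadraticAlgebra (ZMod 5) 2 0))
    (zOf : Fin nz → GL (Fin 2) (QuadraticAlgebra (ZMod 5) 2 0))
    (urep : Fin nt → Fin 2 → QuadraticAlgebra (ZMod 5) 2 0)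
    (hy : Function.Injective yOf) (hz : Function.Injective zOf)
    (hsep : ∀ j : Fin nz, ∃ (R : Fin nt → (Fin 2 → QuadraticAlgebra (ZMod 5) 2 0) → ℤ) (N : ℕ), 0 < N ∧
      ∀ g : Matrix.SpecialLinearGroup (Fin 2) (ZMod 5), ∀ i i' : Fin ny, ∀ l : Fin nz,
      (let X : Matrix (Fin 2) (Fin 2) (QuadraticAlgebra (ZMod 5) 2 0) :=
          ((Matrix.SpecialLinearGroup.mapGL (QuadraticAlgebra (ZMod 5) 2 0) g * yOf i * (yOf i')⁻¹ * zOf l :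
            GL (Fin 2) (QuadraticAlgebra (ZMod 5) 2 0)) : Matrix (Fin 2) (Fin 2) (QuadraticAlgebra (ZMod 5) 2 0))
        let x₀₀ : QuadraticAlgebra (ZMod 5) 2 0 := X 0 0
        let x₀₁ : QuadraticAlgebra (ZMod 5) 2 0 := X 0 1
        let x₁₀ : QuadraticAlgebra (ZMod 5) 2 0 := X 1 0
        let x₁₁ : QuadraticAlgebra (ZMod 5) 2 0 := X 1 1
        ∑ t : Fin nt, R t (!![x₀₀, x₀₁; x₁₀, x₁₁].mulVec (urep t))) =
        if g = 1 ∧ yOf i = yOf i' ∧ zOf l = zOf j then (N : ℤ) else 0) :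
    ∃ (k K : Type) (_ : Field k) (_ : Fintype k) (_ : DecidableEq k)
      (_ : Field K) (_ : Fintype K) (_ : DecidableEq K)
      (φ : Matrix.SpecialLinearGroup (Fin 2) k →* Matrix.GeneralLinearGroup (Fin 2) K),
      Function.Injective φ ∧ Fintype.card K = Fintype.card k ^ 2 ∧ Fintype.card K = 25 ∧
      ∃ Y Z : Finset (Matrix.GeneralLinearGroup (Fin 2) K),
        Y.card = ny ∧ Z.card = nz ∧
        ∀ z₀ ∈ Z, ∃ cf : (Fin 2 → K) → (Fin 2 → K) → ℂ,
          ∀ a : Matrix.SpecialLinearGroup (Fin 2) k, ∀ y ∈ Y, ∀ y' ∈ Y, ∀ z ∈ Z,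
            (∑ u : Fin 2 → K, cf u (((φ a * y * y'⁻¹ * z : Matrix.GeneralLinearGroup (Fin 2) K) :
                Matrix (Fin 2) (Fin 2) K).mulVec u)) =
              if a = 1 ∧ y = y' ∧ z = z₀ then 1 else 0 := by
  choose R N hN key using hsep
  exact subfieldCell_twentyfive_pack_lines (hp := hp) (hF := hF) (hK := hK) h9 yOf zOf urep R N hy hz hN key

end Summit.MatrixMultiplication.MatrixMultiplication.Theorems.GradedDesignFamily
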